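import Summits.RiemannHypothesis.RiemannHypothesis.Theorems.IntegerScrewScrewPolyFloorLandauVisibilitySharp
import Summits.RiemannHypothesis.RiemannHypothesis.Theorems.IntegerScrewScrewPolyFloorSplit
import HarnessLib

/-!
# Route IntegerScrew — RH is equivalent to the cubic rungs of the screw ladder

Helper file for crux `IntegerScrew.ScrewPolyFloor` (stmt-RiemannHypothesis-15757). The crux
`ScrewPolyFloor` (a polynomial floor `c M^{−A}` for the screw Gram matrices `S_M` at EVERY level `M`)
is kernel-checked equivalent to RH (`IntegerScrew.screwPolyFloor_iff_riemannHypothesis`). This file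
records the RUNG-BY-RUNG form of that equivalence with the exponent `A = 3` made available by the
RH-free tail floor `tailFloor_sharp`:

* `riemannHypothesisUpTo_of_riemannHypothesis` — RH implies RH up to every height;
* `rungs_of_riemannHypothesis` — under RH, `c (log M)/M³ ∑ x_m² ≤ x·S_M·x` for all `M ≥ M₀`
  (`screwFloor_of_rhUpTo_sharp`);
* `riemannHypothesis_of_rungs` — conversely, cubic rungs from some level on give `Ψ(log m) ≥ 0` at
  every integer (test vector = indicator of `m` at level `max(m, M₀, 2)`), hence RH by the landed
  `DiscreteLandau` (`IntegerScrewSplit.screwDiagonalPositivity_iff_riemannHypothesis`);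
* `riemannHypothesis_iff_eventual_rungs` — `RH ⟺ ∃ c > 0, M₀, ∀ M ≥ M₀, ∀ x, c (log M)/M³ ∑ x_m² ≤ x·S_M·x`.

Together with `offLine_zero_of_rung_failure_sharp` (a failing rung `M` exhibits an off-line zero of
height `≤ M³`) this is the route's two-way, density-free dictionary rung `M` ↔ height `M³`.
-/

noncomputable section

open Complex Finset
open scoped Real

-- the layout-mandated namespace repeats the summit name
set_option linter.dupNamespace false

namespace Summit.RiemannHypothesis.RiemannHypothesis.Theorems.IntegerScrewLandau

open Literature.NumberTheory.LFunctions Literature.NumberTheory.DiophantineGeometry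

/-- RH implies RH up to every height `T` (a zero with `Im s > 0` is neither trivial nor the pole).
[folklore] -/
theorem riemannHypothesisUpTo_of_riemannHypothesis (h : _root_.RiemannHypothesis) (T : ℝ) :
    RiemannHypothesisUpTo T := by
  intro s hs him _
  refine h s hs ?_ ?_
  · rintro ⟨n, hn⟩
    have := congrArg Complex.im hn
    simp at this
    linarith
  · intro h1
    rw [h1] at him
    simp at him

/-- **Cubic rungs under RH.** Under RH there are `c > 0` and `M₀` with
`c (log M)/M³ ∑_{2≤m≤M} x_m² ≤ ∑_{2≤m,m'≤M} G(log m, log m') x_m x_m'` for all `M ≥ M₀` and all real `x`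
(`screwFloor_of_rhUpTo_sharp`). [folklore] -/
theorem rungs_of_riemannHypothesis (h : _root_.RiemannHypothesis) :
    ∃ (c : ℝ) (M₀ : ℕ), 0 < c ∧ ∀ M : ℕ, M₀ ≤ M → ∀ x : ℕ → ℝ,
      c * Real.log M / (M : ℝ) ^ 3 * ∑ m ∈ Icc 2 M, x m ^ 2 ≤
        ∑ m ∈ Icc 2 M, ∑ m' ∈ Icc 2 M, zetaScrewKernel (Real.log m) (Real.log m') * (x m * x m') := by
  obtain ⟨c, M₀, hc, hf⟩ := screwFloor_of_rhUpTo_sharp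
  exact ⟨c, M₀, hc, fun M hM x ↦ hf M hM (riemannHypothesisUpTo_of_riemannHypothesis h _) x⟩

/-- **Cubic rungs from some level on imply RH.** If for some `c > 0` and `M₀` the inequality
`c (log M)/M³ ∑_{2≤m≤M} x_m² ≤ ∑_{2≤m,m'≤M} G(log m, log m') x_m x_m'` holds for all `M ≥ M₀` and all
real `x`, then `Ψ(log m) ≥ 0` for every `m ≥ 1` (indicator test vectors; `G(t,t) = 2Ψ(t)`,
`Ψ(0) = 0`), hence RH (`DiscreteLandau`). [folklore] -/
theorem riemannHypothesis_of_rungs {c : ℝ} {M₀ : ℕ} (hc : 0 < c)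
    (h : ∀ M : ℕ, M₀ ≤ M → ∀ x : ℕ → ℝ,
      c * Real.log M / (M : ℝ) ^ 3 * ∑ m ∈ Icc 2 M, x m ^ 2 ≤
        ∑ m ∈ Icc 2 M, ∑ m' ∈ Icc 2 M, zetaScrewKernel (Real.log m) (Real.log m') * (x m * x m')) :
    _root_.RiemannHypothesis := by
  classical
  refine IntegerScrewSplit.screwDiagonalPositivity_iff_riemannHypothesis.1 fun m hm1 ↦ ?_
  rcases Nat.lt_or_ge m 2 with hlt | hm
  · have h1 : m = 1 := by omega
    subst h1
    simp [zetaScrew_zero]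
  set M : ℕ := max m (max M₀ 2) with hMdef
  have hMm : m ≤ M := le_max_left _ _
  have hM₀ : M₀ ≤ M := (le_max_left _ _).trans (le_max_right _ _)
  have hM2 : 2 ≤ M := (le_max_right _ _).trans (le_max_right _ _)
  set x : ℕ → ℝ := fun k ↦ if k = m then 1 else 0 with hx
  have hmem : m ∈ Icc 2 M := Finset.mem_Icc.mpr ⟨hm, hMm⟩
  have h1 := h M hM₀ x
  have hR : ∑ a ∈ Icc 2 M, ∑ b ∈ Icc 2 M, zetaScrewKernel (Real.log a) (Real.log b) * (x a * x b) =
      zetaScrewKernel (Real.log m) (Real.log m) := by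
    rw [Finset.sum_eq_single m]
    · rw [Finset.sum_eq_single m]
      · simp [hx]
      · intro b _ hb
        simp [hx, hb]
      · intro hnot
        exact absurd hmem hnot
    · intro a _ ha
      apply Finset.sum_eq_zero
      intro b _
      simp [hx, ha]
    · intro hnot
      exact absurd hmem hnot
  have hL : ∑ a ∈ Icc 2 M, x a ^ 2 = 1 := by
    rw [Finset.sum_eq_single m]
    · simp [hx]
    · intro b _ hb
      simp [hx, hb]
    · intro hnot
      exact absurd hmem hnot
  have hM2r : (2 : ℝ) ≤ M := by exact_mod_cast hM2
  have hlog : 0 ≤ Real.log M := Real.log_nonneg (by linarith)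
  have hL0 : 0 ≤ c * Real.log M / (M : ℝ) ^ 3 * ∑ a ∈ Icc 2 M, x a ^ 2 := by
    rw [hL, mul_one]; positivity
  have h2 : 0 ≤ zetaScrewKernel (Real.log m) (Real.log m) := by
    rw [← hR]; exact le_trans hL0 h1
  rw [zetaScrewKernel_self] at h2
  linarith

/-- **RH ⟺ the cubic rungs of the screw ladder hold from some level on.**
`RH ↔ ∃ c > 0, M₀, ∀ M ≥ M₀, ∀ x, c (log M)/M³ ∑_{2≤m≤M} x_m² ≤ ∑_{2≤m,m'≤M} G(log m, log m') x_m x_m'`.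
[folklore] -/
theorem riemannHypothesis_iff_eventual_rungs :
    _root_.RiemannHypothesis ↔
      ∃ (c : ℝ) (M₀ : ℕ), 0 < c ∧ ∀ M : ℕ, M₀ ≤ M → ∀ x : ℕ → ℝ,
        c * Real.log M / (M : ℝ) ^ 3 * ∑ m ∈ Icc 2 M, x m ^ 2 ≤
          ∑ m ∈ Icc 2 M, ∑ m' ∈ Icc 2 M, zetaScrewKernel (Real.log m) (Real.log m') * (x m * x m') :=
  ⟨rungs_of_riemannHypothesis, fun ⟨_, _, hc, h⟩ ↦ riemannHypothesis_of_rungs hc h⟩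

end Summit.RiemannHypothesis.RiemannHypothesis.Theorems.IntegerScrewLandau

end
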